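import Mathlib

/-!
# Orbit designs for `ThinPackings`: invariance spreads a coefficient over an orbit (F4)

Line `automorphism-orbit-twisted-templates` (skeleton `Ideator4Sketch`) of crux
`ThinBlockAlpha.ThinPackings` (stmt-MatrixMultiplication-10595), stub `stub_invariantCoeff`.

A finite group `Γ` acts on a finite abelian group `H` by additive automorphisms
(`DistribMulAction Γ H`).  For a character `ψ : AddChar H ℂ` and `g : Γ` the twisted character is
`ψ ∘ g := ψ.compAddMonoidHom (DistribSMul.toAddMonoidHom H g)`.  If `X ⊆ H` is `Γ`-invariant,
every finset of elements `g` with `ψ ∘ g = ψ` has size `≤ S`, and `∑_χ ‖X̂(χ)‖² ≤ P`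
(where `X̂(χ) = ∑_{x ∈ X} χ x`), then `|Γ| · ‖X̂(ψ)‖² ≤ S · P`.

Proof.  (1) Invariance: `X̂(ψ ∘ g) = X̂(ψ)` by reindexing the sum along the bijection `x ↦ g • x`
of `X`.  (2) Fibres: the twisting map `g ↦ ψ ∘ g` has fibres of size `≤ S`, since a fibre through
`g'` maps injectively by `g ↦ g * g'⁻¹` into the stabiliser of `ψ`; hence
`|Γ| ≤ S · #{ψ ∘ g : g ∈ Γ}` (`Finset.card_le_mul_card_image`).  (3) The characters `ψ ∘ g` all
carry the coefficient of `ψ`, so `#{ψ ∘ g} · ‖X̂(ψ)‖² ≤ ∑_χ ‖X̂(χ)‖² ≤ P`.  Mathlib only.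
-/

set_option linter.dupNamespace false  -- `Summit.<S>.<S>.…` is the mandated namespace

namespace Summit.MatrixMultiplication.MatrixMultiplication.Theorems.ThinPackings.Orbit

open Finset

/-- **Invariance.** The character sum over a `Γ`-invariant finset `X` is unchanged by twisting the
character by any `g : Γ`: `∑_{x ∈ X} ψ (g • x) = ∑_{x ∈ X} ψ x` (reindex along `x ↦ g • x`). -/
theorem charSum_twist_eq {Γ H : Type} [Group Γ] [AddCommGroup H] [DistribMulAction Γ H]
    (X : Finset H) (hX : ∀ g : Γ, ∀ x ∈ X, g • x ∈ X) (ψ : AddChar H ℂ) (g : Γ) :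
    ∑ x ∈ X, ψ.compAddMonoidHom (DistribSMul.toAddMonoidHom H g) x = ∑ x ∈ X, ψ x := by
  simp only [AddChar.compAddMonoidHom_apply, DistribSMul.toAddMonoidHom_apply]
  exact Finset.sum_nbij' (fun x => g • x) (fun x => g⁻¹ • x) (fun x hx => hX g x hx)
    (fun x hx => hX g⁻¹ x hx) (fun x _ => inv_smul_smul g x) (fun x _ => smul_inv_smul g x)
    (fun _ _ => rfl)

/-- **Twists that agree differ by a stabilising element.** If `ψ ∘ g = ψ ∘ g'` then
`ψ ∘ (g * g'⁻¹) = ψ`. -/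
theorem twist_mul_inv_eq_self {Γ H : Type} [Group Γ] [AddCommGroup H] [DistribMulAction Γ H]
    (ψ : AddChar H ℂ) {g g' : Γ}
    (h : ψ.compAddMonoidHom (DistribSMul.toAddMonoidHom H g)
      = ψ.compAddMonoidHom (DistribSMul.toAddMonoidHom H g')) :
    ψ.compAddMonoidHom (DistribSMul.toAddMonoidHom H (g * g'⁻¹)) = ψ := by
  ext y
  have hy := DFunLike.congr_fun h (g'⁻¹ • y)
  simp only [AddChar.compAddMonoidHom_apply, DistribSMul.toAddMonoidHom_apply,
    smul_inv_smul] at hy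
  simpa only [AddChar.compAddMonoidHom_apply, DistribSMul.toAddMonoidHom_apply, mul_smul]
    using hy

/-- **Fibres of the twisting map.** If every finset of elements stabilising `ψ` has size `≤ S`,
then every fibre `{g : ψ ∘ g = ψ ∘ g'}` of the twisting map `g ↦ ψ ∘ g` has size `≤ S`
(it maps injectively into the stabiliser by `g ↦ g * g'⁻¹`). -/
theorem card_filter_twist_eq_le {Γ H : Type} [Group Γ] [Fintype Γ] [DecidableEq Γ]
    [AddCommGroup H] [DistribMulAction Γ H] [DecidableEq (AddChar H ℂ)] (ψ : AddChar H ℂ)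
    (S : ℕ)
    (hS : ∀ T : Finset Γ,
      (∀ g ∈ T, ψ.compAddMonoidHom (DistribSMul.toAddMonoidHom H g) = ψ) → T.card ≤ S)
    (g' : Γ) :
    ((univ : Finset Γ).filter fun g =>
        ψ.compAddMonoidHom (DistribSMul.toAddMonoidHom H g)
          = ψ.compAddMonoidHom (DistribSMul.toAddMonoidHom H g')).card ≤ S := by
  rw [← Finset.card_image_of_injective _ (mul_left_injective g'⁻¹)]
  refine hS _ fun k hk => ?_
  obtain ⟨g, hg, rfl⟩ := Finset.mem_image.mp hk
  exact twist_mul_inv_eq_self ψ (Finset.mem_filter.mp hg).2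

/-- **Counting the orbit of a character.** If every finset of elements stabilising `ψ` has size
`≤ S`, the twisting map `g ↦ ψ ∘ g` takes at least `|Γ| / S` values:
`|Γ| ≤ S · #(univ.image (g ↦ ψ ∘ g))`. -/
theorem card_le_mul_card_image_twist {Γ H : Type} [Group Γ] [Fintype Γ]
    [AddCommGroup H] [DistribMulAction Γ H] [DecidableEq (AddChar H ℂ)] (ψ : AddChar H ℂ)
    (S : ℕ)
    (hS : ∀ T : Finset Γ,
      (∀ g ∈ T, ψ.compAddMonoidHom (DistribSMul.toAddMonoidHom H g) = ψ) → T.card ≤ S) :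
    Fintype.card Γ
      ≤ S * ((univ : Finset Γ).image fun g =>
          ψ.compAddMonoidHom (DistribSMul.toAddMonoidHom H g)).card := by
  classical
  rw [← Finset.card_univ]
  refine Finset.card_le_mul_card_image _ S fun a ha => ?_
  obtain ⟨g', -, rfl⟩ := Finset.mem_image.mp ha
  convert card_filter_twist_eq_le ψ S hS g'

/-- **(F4) Invariance spreads a coefficient over an orbit of characters.**  Let the finite group
`Γ` act on the finite abelian group `H` by additive automorphisms, let `X ⊆ H` be `Γ`-invariant and
`ψ : AddChar H ℂ`.  If every finset of elements `g` with `ψ ∘ g = ψ` has size `≤ S` and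
`∑_χ ‖X̂(χ)‖² ≤ P`, then `|Γ| · ‖X̂(ψ)‖² ≤ S · P`: the twisted characters `ψ ∘ g` are at least
`|Γ| / S` many and all carry the coefficient `X̂(ψ)`. [folklore] -/
theorem stub_invariantCoeff : ∀ {Γ H : Type} [Group Γ] [Fintype Γ] [AddCommGroup H] [Fintype H] [DecidableEq H] [DistribMulAction Γ H] (X : Finset H), (∀ g : Γ, ∀ x ∈ X, g • x ∈ X) → ∀ (ψ : AddChar H ℂ) (S : ℕ) (P : ℝ), 0 < S → (∀ T : Finset Γ, (∀ g ∈ T, ψ.compAddMonoidHom (DistribSMul.toAddMonoidHom H g) = ψ) → T.card ≤ S) → ∑ χ : AddChar H ℂ, ‖∑ x ∈ X, χ x‖ ^ 2 ≤ P → (Fintype.card Γ : ℝ) * ‖∑ x ∈ X, ψ x‖ ^ 2 ≤ S * P := by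
  intro Γ H _ _ _ _ _ _ X hX ψ S P _ hS hP
  classical
  -- the orbit of `ψ` under twisting
  set I : Finset (AddChar H ℂ) :=
    (univ : Finset Γ).image fun g => ψ.compAddMonoidHom (DistribSMul.toAddMonoidHom H g)
    with hI
  -- (2) `|Γ| ≤ S · |I|`
  have hcard : Fintype.card Γ ≤ S * I.card := card_le_mul_card_image_twist ψ S hS
  -- (1) + (3): every character of `I` carries the coefficient of `ψ`
  have hsumI : ∑ χ ∈ I, ‖∑ x ∈ X, χ x‖ ^ 2 = (I.card : ℝ) * ‖∑ x ∈ X, ψ x‖ ^ 2 := by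
    have hconst : ∀ χ ∈ I, ‖∑ x ∈ X, χ x‖ ^ 2 = ‖∑ x ∈ X, ψ x‖ ^ 2 := by
      intro χ hχ
      obtain ⟨g, -, rfl⟩ := Finset.mem_image.mp hχ
      rw [charSum_twist_eq X hX ψ g]
    rw [Finset.sum_congr rfl hconst, Finset.sum_const, nsmul_eq_mul]
  have hIP : (I.card : ℝ) * ‖∑ x ∈ X, ψ x‖ ^ 2 ≤ P := by
    rw [← hsumI]
    exact le_trans (Finset.sum_le_univ_sum_of_nonneg fun χ => by positivity) hP
  -- (4) combine
  have hnn : 0 ≤ ‖∑ x ∈ X, ψ x‖ ^ 2 := by positivity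
  have hcardR : (Fintype.card Γ : ℝ) ≤ (S : ℝ) * (I.card : ℝ) := by exact_mod_cast hcard
  calc (Fintype.card Γ : ℝ) * ‖∑ x ∈ X, ψ x‖ ^ 2
      ≤ ((S : ℝ) * I.card) * ‖∑ x ∈ X, ψ x‖ ^ 2 := mul_le_mul_of_nonneg_right hcardR hnn
    _ = (S : ℝ) * ((I.card : ℝ) * ‖∑ x ∈ X, ψ x‖ ^ 2) := by ring
    _ ≤ S * P := mul_le_mul_of_nonneg_left hIP (Nat.cast_nonneg S)

end Summit.MatrixMultiplication.MatrixMultiplication.Theorems.ThinPackings.Orbit
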